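import Literature.AnabelianGeometry.EtaleTheta.Discharge.Sec4Prop43iiHolds
import Literature.AnabelianGeometry.EtaleTheta.Discharge.Sec4GaloisSurjNatural
import Literature.AnabelianGeometry.EtaleTheta.Discharge.Sec5OfConnectedTemperoid
import HarnessLib

/-!
# [EtTh] Prop. 4.3 (ii) ACROSS TWO `N`-th ROOTS: bi-Kummer roots on `N`-th roots `R`, `R'` related by the Prop. 4.2 (iv)
# data `(u, ζ_A, ζ_B)` differ, after transport along `ζ_B`, by (a) simultaneous `O^×(B_N)`-conjugation and (b) the
# non-simultaneous conjugation by `u ∈ μ_N(B_N)` — print's clause beyond the typed same-root case, NO binder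

S. Mochizuki, *The étale theta function and its Frobenioid-theoretic manifestations*, Publ. RIMS **45** (2009) [EtTh], §4,
Prop. 4.3 (ii), printed p.317 (PDF p.91) ll.11–16 (own render `paper:doi-10-2977-prims-1234361159` p0091.txt): "(ii) … the
collection of bi-Kummer `N`-th roots, with `N`-codomain `B_N`, of a fraction-pair with domain isomorphic to `A_⊙`, of some
rational function whose pull-back to `B_N` is equal to `f|_{B_N}`, is equal to the collection of pairs obtained from
`(s'_N{}^{gp}, s''_N{}^{gp})` by (a) simultaneous conjugation by an element `ζ_Aut ∈ O^×(B_N)`, followed by (b) non-simultaneous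
conjugation [of, say, `s''_N{}^{gp}`] by an element `u ∈ μ_N(B_N)` [cf. the '`u`' of Proposition 4.2, (iv)]"; proof p.317
ll.34–36 + p.318 ll.5–11: "assertion (ii) follows immediately by applying Proposition 4.2, (ii), to the fraction-pairs … of
Proposition 4.2, (iv) [after possibly replacing `ŝ''_N` by `u ∘ ŝ''_N`] … since `s_N^{trv}` is completely determined up to
conjugation by an element of `O^×(A_N)`" [cite: MochizukiEtTh2009, Prop 4.3 (ii) p.91].

PROOF-ONLY companion (theorems only; abc-iut cell, layer L2, cone node `EtTh:Prop4.3(ii)`; abc-iut-L2-lead gen 7 R999 banked row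
«P43ii-E2» = census item (P1b) of abc-iut-w6-d078 g5 / note N-P43ii-1; seat abc-iut-w5-d179 gen 8).  abc-iut-L2-t3's typed node
`BiKummerSetting.Prop43_ii` (BiKummerRoots.lean, disclosed there as «the same-`N`-th-root case of print's (ii)») compares two
bi-Kummer roots on ONE `N`-th root `R`; its universal closure is abc-iut-f-111's `prop43_ii_holds` (p430175).  Print's sentence
also ranges over bi-Kummer roots with the same `N`-codomain on OTHER `N`-th roots, which print reduces to the same-root case by
the isomorphisms `(ζ_A, ζ_B)` and the unit `u ∈ μ_N(B_N)` of Prop. 4.2 (iv).  This file proves that reduction in the typed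
vocabulary, consuming BY NAME abc-iut-f-111's divisoriality-free cancellation `TemperedFrobenioid.aut_conj_of_comp_eq` and unit
lift `NthRoot.exists_units_lift'`, and abc-iut-w5-d013's transport `hAbs_map_conjAut_of_natural` (nothing landed is edited):
* §1 `comp_conjAut_symm_of_comm` — transport of a commutation square `s' ∘ σ' = τ' ∘ s'` along isomorphisms `e_X, e_Y` with
  `e_X ∘ s' = s ∘ e_Y` back to `s`.
* §2 **`BiKummerRoot.sections_conj_of_prop42ivData`** — for `N`-th roots `R`, `R'` of the SAME fraction pair and Prop. 4.2 (iv)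
  data `hnum : ζ_A ∘ s'_{N,R'} = s'_{N,R} ∘ ζ_B`, `hden : ζ_A ∘ s''_{N,R'} = s''_{N,R} ∘ u ∘ ζ_B` (`u ∈ μ_N(B_N)`), ANY bi-Kummer roots
  `K` on `R`, `K'` on `R'` whose trivialising sections agree after transport along `ζ_A` up to `O^×(A_N)`-conjugation (print:
  «`s^{trv}_N` is completely determined up to conjugation by an element of `O^×(A_N)`») satisfy, for every pair `(h, h')` of
  `ζ_A`-matched elements of `H_{A_N}`, `H_{A'_N}`:  `ζ_B^* s'^{gp}_{K'}(h') = ζ · s'^{gp}_K(h) · ζ⁻¹` and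
  `ζ_B^* s''^{gp}_{K'}(h') = (u ζ) · s''^{gp}_K(h) · (u ζ)⁻¹` with ONE `ζ ∈ O^×(B_N)` — print's (a)+(b); NO binder, every setting.
* §3 NON-VACUITY of the matching: under the OUTER NATURALITY law of the Galois surjections (abc-iut-w5-d013's field-shape binder
  `hS`, Def. 4.1 (ii) «outer»; a THEOREM at the §5 data of record, `mkOfConnectedTemperoid_galoisSurj_natural`) `ζ_A`-conjugation
  carries `H_{A_N}` into `H_{A'_N}` (`autBase_conjAut`, `conjAut_mem_HA_of_natural`), so every `h` HAS a match
  (`exists_matched_of_natural`); outright at `mkOfConnectedTemperoid` (`conjAut_mem_HA_mkOfConnectedTemperoid`).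
HONEST FRAMING: refereed pre-IUT material ([EtTh] §4 over [FrdI]); the «⊇» half of print's «is equal to» (every (a)(b)-conjugate
OCCURS as a bi-Kummer root of a suitable pair) is NOT treated here (abc-iut-w6-d078's (E1), banked); nothing here asserts that such
data exist for an actual curve; nothing bears on [IUTchIII] Cor. 3.12; no side taken; typed ≠ proved — here PROVED.
-/

noncomputable section

namespace Literature.AnabelianGeometry.EtaleTheta

open CategoryTheory Opposite Literature.AlgebraicGeometry.Frobenioids

universe u₀ v₀ u v w

/-! ### §1 Transport of a commutation square along a pair of isomorphisms -/

/-- Transport of `s' ≫ σ' = τ' ≫ s'` along `e_X : X ≅ X'`, `e_Y : Y ≅ Y'` with `e_X ≫ s' = s ≫ e_Y`: the pulled-back automorphisms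
satisfy `s ≫ (e_Y^* σ') = (e_X^* τ') ≫ s`. [cite: MochizukiEtTh2009, Prop 4.3 (ii) p.91] -/
theorem comp_conjAut_symm_of_comm {C : Type u} [Category.{v} C] {X Y X' Y' : C} (s : X ⟶ Y) (s' : X' ⟶ Y') (eX : X ≅ X')
    (eY : Y ≅ Y') (hs : eX.hom ≫ s' = s ≫ eY.hom) {σ' : Aut Y'} {τ' : Aut X'} (c : s' ≫ σ'.hom = τ'.hom ≫ s') :
    s ≫ (eY.symm.conjAut σ').hom = (eX.symm.conjAut τ').hom ≫ s := by
  have hs' : s' ≫ eY.inv = eX.inv ≫ s := by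
    rw [Iso.eq_inv_comp, ← Category.assoc, hs, Category.assoc, Iso.hom_inv_id, Category.comp_id]
  rw [Iso.conjAut_hom, Iso.conjAut_hom, Iso.conj_apply, Iso.conj_apply, Iso.symm_inv, Iso.symm_hom, Iso.symm_inv, Iso.symm_hom,
    Category.assoc, Category.assoc, ← reassoc_of% hs, reassoc_of% c, hs']

namespace BiKummerSetting

variable {K : Type u₀} [Field K] {X : SemiGraphs.TemperedArithmeticGroup.{u₀} K} {D₀ : Type u₀} [Category.{v₀} D₀]
  {V : FrdIMonoidStub.{w}} {T : RealifiedDivisorMonoids (D₀ := D₀) V} {D : Type u} [Category.{v} D]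
  {VD : FrdICatStub.{u, v, w} D} {S : BiKummerSetting X T D VD}

namespace BiKummerRoot

variable {A Bo : S.C} {f : S.biratUnits A} {P : S.FractionPair f Bo} {N : ℕ+}
  {pullFrac : ∀ {A A' : S.C} (_ : A' ⟶ A), S.biratUnits A → S.biratUnits A'}
  {R R' : S.NthRoot f P N pullFrac} {hA : S.IsGalois R.AN} {hB : S.IsGalois R.BN} {hA' : S.IsGalois R'.AN}
  {hB' : S.IsGalois R'.BN} (K : S.BiKummerRoot R hA hB) (K' : S.BiKummerRoot R' hA' hB')

/-! ### §2 Prop. 4.3 (ii) across two `N`-th roots related by the Prop. 4.2 (iv) data -/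

/-- **[EtTh] Prop. 4.3 (ii) ACROSS TWO `N`-th ROOTS** of the same fraction-pair, related by the Prop. 4.2 (iv) data `(u, ζ_A, ζ_B)`
(`ζ_A ∘ s'_{N,R'} = s'_{N,R} ∘ ζ_B`, `ζ_A ∘ s''_{N,R'} = s''_{N,R} ∘ u ∘ ζ_B`, `u ∈ μ_N(B_N)`): if the trivialising sections of the
bi-Kummer roots `K` (on `R`) and `K'` (on `R'`) agree after transport along `ζ_A` up to conjugation by `ζ_u ∈ O^×(A_N)`, then for ONE
`ζ ∈ O^×(B_N)` (the lift of `ζ_u`) and every `ζ_A`-matched pair `(h, h')`: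
`ζ_B^* s'^{gp}_{K'}(h') = ζ s'^{gp}_K(h) ζ⁻¹` — (a) — and `ζ_B^* s''^{gp}_{K'}(h') = (u ζ) s''^{gp}_K(h) (u ζ)⁻¹` — (a) then (b).
NO binder; every setting of §4. [cite: MochizukiEtTh2009, Prop 4.3 (ii) p.91] -/
theorem sections_conj_of_prop42ivData (u : S.mu R.BN N) (ζA : R.AN ≅ R'.AN) (ζB : R.BN ≅ R'.BN)
    (hnum : ζA.hom ≫ R'.pair.num = R.pair.num ≫ ζB.hom)
    (hden : ζA.hom ≫ R'.pair.den = (R.pair.den ≫ (u : Aut R.BN).hom) ≫ ζB.hom)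
    {ζu : Aut R.AN} (hζu : ζu ∈ S.units R.AN)
    (hstriv : ∀ (h : S.HA R.AN hA) (h' : S.HA R'.AN hA'), ζA.symm.conjAut (h' : Aut R'.AN) = (h : Aut R.AN) →
      ζA.symm.conjAut (K'.striv h') = ζu * K.striv h * ζu⁻¹) :
    ∃ ζ : Aut R.BN, ζ ∈ S.units R.BN ∧
      ∀ (h : S.HA R.AN hA) (h' : S.HA R'.AN hA'), ζA.symm.conjAut (h' : Aut R'.AN) = (h : Aut R.AN) →
        ζB.symm.conjAut (K'.sNum (K'.ident h')) = ζ * K.sNum (K.ident h) * ζ⁻¹ ∧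
        ζB.symm.conjAut (K'.sDen (K'.ident h')) = ((u : Aut R.BN) * ζ) * K.sDen (K.ident h) * ((u : Aut R.BN) * ζ)⁻¹ := by
  obtain ⟨ζ, hζ, hnumζ, hdenζ⟩ := R.exists_units_lift' hζu
  haveI : IsIso (ModelFrobenioid.baseMap R.pair.num) := R.pair.isPreStep_num.2
  haveI : IsIso (ModelFrobenioid.baseMap R.pair.den) := R.pair.isPreStep_den.2
  refine ⟨ζ, hζ, fun h h' hh' => ?_⟩
  have hτ := hstriv h h' hh'
  constructor
  · -- numerator: transport `s'_{N,R'} ∘ s'^{gp}(h') = s^{trv}(h') ∘ s'_{N,R'}` along `(ζ_A, ζ_B)` and cancel against `K.comm_num h`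
    have c' := comp_conjAut_symm_of_comm R.pair.num R'.pair.num ζA ζB hnum (K'.comm_num h')
    rw [hτ] at c'
    exact S.tf.aut_conj_of_comp_eq R.pair.num (K.comm_num h) c' hnumζ rfl
  · -- denominator: the same along `(ζ_A, u ∘ ζ_B)`; the extra `u` is print's non-simultaneous conjugation (b)
    have hden' : ζA.hom ≫ R'.pair.den = R.pair.den ≫ ((u : Aut R.BN) ≪≫ ζB).hom := by rw [hden, Iso.trans_hom, Category.assoc]
    have c' := comp_conjAut_symm_of_comm R.pair.den R'.pair.den ζA ((u : Aut R.BN) ≪≫ ζB) hden' (K'.comm_den h')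
    rw [hτ] at c'
    have key := S.tf.aut_conj_of_comp_eq R.pair.den (K.comm_den h) c' hdenζ rfl
    -- `(u ∘ ζ_B)^* σ = u⁻¹ (ζ_B^* σ) u`
    have e : ((u : Aut R.BN) ≪≫ ζB).symm.conjAut (K'.sDen (K'.ident h')) =
        (u : Aut R.BN)⁻¹ * ζB.symm.conjAut (K'.sDen (K'.ident h')) * (u : Aut R.BN) := by
      refine Aut.ext ?_
      simp only [Iso.conjAut_hom, Iso.conj_apply, Iso.symm_inv, Iso.symm_hom, Iso.trans_hom, Iso.trans_inv, Aut.Aut_mul_def,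
        Aut.Aut_inv_def, Category.assoc]
    rw [e] at key
    -- solve for `ζ_B^* σ`: `u⁻¹ X u = ζ s ζ⁻¹` gives `X = (u ζ) s (u ζ)⁻¹`
    have key' : ζB.symm.conjAut (K'.sDen (K'.ident h')) = (u : Aut R.BN) * (ζ * K.sDen (K.ident h) * ζ⁻¹) * (u : Aut R.BN)⁻¹ := by
      rw [← key]; group
    rw [key']
    group

end BiKummerRoot

/-! ### §3 Non-vacuity of the matching: `ζ_A`-conjugation carries `H_{A_N}` onto `H_{A'_N}` -/

section Natural

variable (S)

/-- `Base` commutes with conjugation by an isomorphism: `Base(ζ^* σ) = Base(ζ)^* Base(σ)`. [cite: MochizukiEtTh2009, Def 4.1 p.87] -/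
theorem autBase_conjAut {A₁ A₂ : S.C} (e : A₁ ≅ A₂) (σ : Aut A₁) :
    S.autBase A₂ (e.conjAut σ) = (S.base.mapIso e).conjAut (S.autBase A₁ σ) := by
  refine Aut.ext ?_
  change S.base.map (e.conjAut σ).hom = ((S.base.mapIso e).conjAut (S.base.mapAut A₁ σ)).hom
  rw [Iso.conjAut_hom, Iso.conjAut_hom, Iso.conj_apply, Iso.conj_apply, Functor.map_comp, Functor.map_comp, Functor.mapIso_inv,
    Functor.mapIso_hom]
  rfl

/-- **Under the outer naturality law of the Galois surjections, conjugation by an isomorphism `e : A₁ ≅ A₂` of Galois objects of `C`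
carries `H_{A₁}` into `H_{A₂}`** (`H_A = autBase⁻¹(H_A^bs)`, `H_A^bs` the image of the NORMAL `H_⊙`; abc-iut-w5-d013's
`hAbs_map_conjAut_of_natural`). [cite: MochizukiEtTh2009, Def 4.1 p.87] -/
theorem conjAut_mem_HA_of_natural
    (hS : ∀ ⦃A B : D⦄ (hA : S.IsGaloisObj A) (hB : S.IsGaloisObj B) (b : B ⟶ A),
      ∃ c : X.Pi, ∀ g : X.Pi, (S.galoisSurj B hB g).hom ≫ b = b ≫ (S.galoisSurj A hA (c * g * c⁻¹)).hom)
    {A₁ A₂ : S.C} (h₁ : S.IsGalois A₁) (h₂ : S.IsGalois A₂) (e : A₁ ≅ A₂) {σ : Aut A₁} (hσ : σ ∈ S.HA A₁ h₁) :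
    e.conjAut σ ∈ S.HA A₂ h₂ := by
  change S.autBase A₂ (e.conjAut σ) ∈ S.HAbs A₂ h₂
  rw [autBase_conjAut, ← S.hAbs_map_conjAut_of_natural hS A₂ A₁ h₂ h₁ (S.base.mapIso e)]
  exact Subgroup.mem_map_of_mem _ hσ

/-- Hence every `h ∈ H_{A_N}` has a `ζ_A`-MATCHED partner `h' := ζ_A-conjugate ∈ H_{A'_N}` (the hypothesis shape of
`sections_conj_of_prop42ivData` is inhabited for every `h`). [cite: MochizukiEtTh2009, Def 4.1 p.87] -/
theorem exists_matched_of_natural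
    (hS : ∀ ⦃A B : D⦄ (hA : S.IsGaloisObj A) (hB : S.IsGaloisObj B) (b : B ⟶ A),
      ∃ c : X.Pi, ∀ g : X.Pi, (S.galoisSurj B hB g).hom ≫ b = b ≫ (S.galoisSurj A hA (c * g * c⁻¹)).hom)
    {A₁ A₂ : S.C} (h₁ : S.IsGalois A₁) (h₂ : S.IsGalois A₂) (e : A₁ ≅ A₂) (h : S.HA A₁ h₁) :
    ∃ h' : S.HA A₂ h₂, e.symm.conjAut (h' : Aut A₂) = (h : Aut A₁) :=
  ⟨⟨e.conjAut h, S.conjAut_mem_HA_of_natural hS h₁ h₂ e h.2⟩, by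
    refine Aut.ext ?_
    change (e.symm.conjAut (e.conjAut (h : Aut A₁))).hom = (h : Aut A₁).hom
    simp only [Iso.conjAut_hom, Iso.conj_apply, Iso.symm_inv, Iso.symm_hom, Category.assoc, Iso.hom_inv_id, Category.comp_id,
      Iso.hom_inv_id_assoc]⟩

end Natural

/-! ### At the §5 data of record `mkOfConnectedTemperoid`: the matching is inhabited outright -/

section Connected

variable (X) {VD' : FrdICatStub.{u₀ + 1, u₀, w} (ConnectedPart (SemiGraphs.BTemp X.Pi))}
  (tf : TemperedFrobenioid T (ConnectedPart (SemiGraphs.BTemp X.Pi)) VD') (hZ : tf.monoidType = MonoidType.Z)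
  (hP : ∀ A : (ConnectedPart (SemiGraphs.BTemp X.Pi))ᵒᵖ, IsPerfect (tf.Φ.carrier A))
  (NH : Subgroup (Field.absoluteGaloisGroup K) → tf.category → ℕ+ → Prop) (A₀ : tf.category)
  (hA₀ : PreFrobenioid.IsFrobeniusTrivial tf.toElem A₀) (hA₀' : SemiGraphs.IsGaloisObj A₀.base.obj)

/-- **At the §5 data of record** the outer naturality law is a THEOREM (`mkOfConnectedTemperoid_galoisSurj_natural`), so conjugation
by any isomorphism of Galois objects carries `H_{A₁}` into `H_{A₂}` with NO binder. [cite: MochizukiEtTh2009, Def 4.1 p.87] -/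
theorem conjAut_mem_HA_mkOfConnectedTemperoid {A₁ A₂ : (mkOfConnectedTemperoid X tf hZ hP NH A₀ hA₀ hA₀').C}
    (h₁ : (mkOfConnectedTemperoid X tf hZ hP NH A₀ hA₀ hA₀').IsGalois A₁)
    (h₂ : (mkOfConnectedTemperoid X tf hZ hP NH A₀ hA₀ hA₀').IsGalois A₂) (e : A₁ ≅ A₂) {σ : Aut A₁}
    (hσ : σ ∈ (mkOfConnectedTemperoid X tf hZ hP NH A₀ hA₀ hA₀').HA A₁ h₁) :
    e.conjAut σ ∈ (mkOfConnectedTemperoid X tf hZ hP NH A₀ hA₀ hA₀').HA A₂ h₂ :=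
  (mkOfConnectedTemperoid X tf hZ hP NH A₀ hA₀ hA₀').conjAut_mem_HA_of_natural
    (mkOfConnectedTemperoid_galoisSurj_natural X tf hZ hP NH A₀ hA₀ hA₀') h₁ h₂ e hσ

end Connected

end BiKummerSetting

end Literature.AnabelianGeometry.EtaleTheta

end
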